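import Summits.QuantumFields.BalabanUV.T4Continuum.Support.NE9LocalTwoPoint

/-!
# NE9DilatedTables — [S1-c] PROVED AS A KERNEL COMPOSITION: small-field analyticity of the tables on the complex
(1.34)-type polydisc of radius `(1+c)ε₁` ∘ the (2.12) dilation structure ⇒ holomorphy in the DILATED COUPLING on the
discs about the real couplings, for every sample that is small-field at the LARGER coupling ⇒ Cauchy ⇒ the table
channel's pointwise modulus; composed with the localised two-point bound of `NE9LocalTwoPoint` (cell `pub-balaban`,
T4-DAG §2 node U3 / §6 NE9; lineage t4-ne9-p1 = prover P1 «analytic-dependence route», generation 20; census §27 of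
`t4/T4-EST-NE9-P1.md`)

HONEST FRAMING (T4-DAG PAGE 1).  The cell's T⁴ target is rung (B)+1: existence AND uniqueness of the ε → 0 limit of
gauge-invariant observables of pure YM₄ on a FIXED finite torus, with `FlowStep.BetaPertH` and Bałaban's UV stability (B)
as EXPLICIT hypotheses — NOT infinite volume, NOT a mass gap, NOT the Clay problem.  NE9 (`T4OutputRate.NE9` ∧
`FadingMemory`) is a cell NEW ESTIMATE, NOT PRINTED, and is NOT discharged here.  This module is one complex variable
over ABSTRACT carriers (a complex normed space `W` of complexified fluctuation fields with bond coordinates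
`ℓ b : W →L[ℂ] Vc`, a sample-to-field map `φ : Ω → W`); it asserts NOTHING about Bałaban's functionals.  [I] =
[Balaban1987RG1], [II] = [Balaban1988RG2Cluster] are quoted for the TYPE of displayed hypotheses only (ABSOLUTE RULE).
BetaPertH, (B), (B^μ) do not occur.

WHY THIS LEAF (coordinator's return of 2026-08-19T23:22Z to row NE9, item (2): «[S1-c]: state it as a typed lemma … and
PROVE it»; generation 18 classified [S1-c] a «printed-TYPE instance composed with printed STRUCTURE» and left the
composition unproved).  The (2.12) structure of [I] p. 268 — every term of the exponent is a function of the coupling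
`ζ` times a function of the DILATED field `ζ·B` («power of `g_k` × function of `g_kCB`»; [II] (1.33) p. 9: the curly
bracket is `𝐄_k` at the background shifted by `exp iB′`; [II] p. 11: «the expression `(1/g_k²)V(H₁B′)` … all terms in
`𝐏^{(k)}(g_k, U, J, B)`») — is typed as `dilTables terms a F φ ζ ω = Σ_m a_m(ζ)·F_m(ζ • φ ω)`.  The printed TYPE of
[II] Lemmas 1–2 («defined and analytic on the space (1.34)», bounds (1.36), (1.42)–(1.43)) read at `ε₁ ↦ (1+c)ε₁`
(«ε₁ sufficiently small» is an open condition) is the hypothesis «`F_m` holomorphic on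
`smallFieldPolydisc ab ℓ ((1+c)ε₁) = {w : ‖ℓ_b w‖ < (1+c)ε₁, b ∈ ab}`».  KERNEL: for a sample small-field at the larger
coupling (`‖ℓ_b(φ ω)‖ < ε₁/max(s,s′)`, i.e. `ω ∈ S(s) ∩ S(s′)`, `NE9LocalTwoPoint.abs_lt_of_mem_inter`) and every `ζ`
of the dilation domain `⋃_{x ∈ [min,max]} D̄(x, c·min)` one has `‖ζ‖ ≤ max + c·min`, hence
`‖ℓ_b(ζ • φ ω)‖ < (max + c·min)ε₁/max ≤ (1+c)ε₁`: the dilated field STAYS in the polydisc (`smul_mem_smallFieldPolydisc`);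
the dilated tables are holomorphic there (`differentiableOn_dilTables`, chain rule; negative powers of the coupling are
holomorphic on the dilation domain for aperture `c < 1`, `differentiableOn_zpow_dilationDomain`); Cauchy on the
`c·min`-discs (tree `Dimock2015.real_param_lipschitz`, [DimockYuan2024GNFlow]) gives the pointwise table modulus
`‖V_s(ω) − V_{s′}(ω)‖ ≤ 4ê₁(ω)/(c·min(s,s′))·|s − s′|` (`norm_dilTables_sub_le`).  So [S1-c] is a THEOREM whose only
displayed inputs are the QUALITATIVE analyticity (Lemma 1–2 TYPE at `(1+c)ε₁`) and the QUANTITATIVE box bound `ê₁` of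
the dilated tables ((1.36)/(1.43)/(2.20) TYPE at `(1+c)ε₁`).  §2 composes with `NE9LocalTwoPoint`:
`norm_formAct_sub_formAct_le_dilTables` — the two-point bound in the last coupling for (2.14)-form activities whose exponent
has the dilation structure; no holomorphy is asked of any sample outside `S(s) ∩ S(s′)`.

NOT PROVED HERE / residual (census §27): the box bounds; the (A″)-type integrals `T₁` [PROOF-INTERIOR of (B)]; (SHELL)
is kernel in Gaussian letters (`NE9TiltedShell`) up to the dictionary (2.15)–(2.22); bond variables with `dim 𝔤 > 1`
(radial shells).  NOT summit progress; 0/9 → 0/9.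

References (TYPES only): [Balaban1987RG1] T. Bałaban, CMP 109 (1987) 249–301, (2.12)–(2.13) p. 268;
[Balaban1988RG2Cluster] T. Bałaban, CMP 116 (1988) 1–22, (1.33)–(1.36) p. 9, Lemma 2 / (1.41)–(1.43) p. 11,
(2.14)–(2.15) p. 15, (2.20) p. 16; [DimockYuan2024GNFlow] J. Dimock, C. Yuan, AHP 25 (2024), proof of Thm 4 (the
Cauchy-with-margin step, tree `Dimock2015.AnalyticLipschitz`).
-/

noncomputable section

namespace Summit.QuantumFields.BalabanUV.T4Continuum.NE9DilatedTables

open MeasureTheory Set Metric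
open scoped BigOperators symmDiff
open Literature.MathematicalPhysics.QuantumFieldTheory.Dimock2015
open Summit.QuantumFields.BalabanUV.T4Continuum.NE9CouplingTwoPoint
open Summit.QuantumFields.BalabanUV.T4Continuum.NE9LocalTwoPoint

/-! ## §1 [S1-c]: small-field analyticity ∘ the (2.12) dilation structure ⇒ holomorphy in the dilated coupling ⇒ the
pointwise table modulus (Cauchy) -/

section Dilation

variable {W : Type*} [NormedAddCommGroup W] [NormedSpace ℂ W] {Vc : Type*} [NormedAddCommGroup Vc]
  [NormedSpace ℂ Vc] {Bd : Type*}

/-- The complex small-field space of [II] (1.34) p. 9 «{B : |B| < ε₁g_k^{−1} on Y}» in the DILATED variable `W = g_kB`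
(radius `R`, in the instance `R = (1+c)ε₁`): complexified fields whose bond coordinates `ℓ_b` (complex-linear,
`𝔤^ℂ`-valued) are below `R` on the bond set `ab`. [cite: Balaban1988RG2Cluster, (1.34) p.9] -/
def smallFieldPolydisc (ab : Finset Bd) (ℓ : Bd → W →L[ℂ] Vc) (R : ℝ) : Set W :=
  {w | ∀ b ∈ ab, ‖ℓ b w‖ < R}

/-- The small-field polydisc is open. [folklore] -/
theorem isOpen_smallFieldPolydisc (ab : Finset Bd) (ℓ : Bd → W →L[ℂ] Vc) (R : ℝ) :
    IsOpen (smallFieldPolydisc ab ℓ R) := by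
  have h : smallFieldPolydisc ab ℓ R = ⋂ b ∈ ab, {w | ‖ℓ b w‖ < R} := by
    ext w
    simp [smallFieldPolydisc]
  rw [h]
  exact isOpen_biInter_finset fun b _ => isOpen_lt (continuous_norm.comp (ℓ b).continuous) continuous_const

/-- The DILATION DOMAIN in the complex coupling: the union of the closed discs of radius `r` about the real couplings of
`[lo, hi]` (in the instance `[lo, hi] = [min(s,s′), max(s,s′)]`, `r = c·min(s,s′)`). [folklore] -/
def dilationDomain (lo hi r : ℝ) : Set ℂ := ⋃ x ∈ Icc lo hi, closedBall (x : ℂ) r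

/-- Each disc about a real coupling of the segment lies in the dilation domain (the `hD` clause of
`Dimock2015.real_param_lipschitz`). [folklore] -/
theorem closedBall_subset_dilationDomain {lo hi r : ℝ} {x : ℝ} (hx : x ∈ Icc lo hi) :
    closedBall (x : ℂ) r ⊆ dilationDomain lo hi r := by
  intro ζ hζ
  show ζ ∈ ⋃ x ∈ Icc lo hi, closedBall (x : ℂ) r
  exact Set.mem_biUnion hx hζ

/-- On the dilation domain `‖ζ‖ ≤ hi + r` (for `0 ≤ lo`). [folklore] -/
theorem norm_le_of_mem_dilationDomain {lo hi r : ℝ} (hlo : 0 ≤ lo) {ζ : ℂ} (hζ : ζ ∈ dilationDomain lo hi r) :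
    ‖ζ‖ ≤ hi + r := by
  simp only [dilationDomain, Set.mem_iUnion, mem_closedBall, exists_prop] at hζ
  obtain ⟨x, hx, hζx⟩ := hζ
  rw [dist_eq_norm] at hζx
  have hx0 : 0 ≤ x := hlo.trans hx.1
  calc ‖ζ‖ = ‖(ζ - x) + x‖ := by rw [sub_add_cancel]
    _ ≤ ‖ζ - (x : ℂ)‖ + ‖(x : ℂ)‖ := norm_add_le _ _
    _ ≤ r + x := add_le_add hζx (by rw [Complex.norm_real, Real.norm_eq_abs, abs_of_nonneg hx0])
    _ ≤ hi + r := by linarith [hx.2]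

/-- On the dilation domain `lo − r ≤ ‖ζ‖`: for `r < lo` (aperture `c < 1` in the instance) the domain stays away from
the origin, so NEGATIVE powers of the coupling (the factor `g_k^{−2}` of `(1/g_k²)V(g_kH₁B′)`, [II] p. 11) are holomorphic
there. [folklore] -/
theorem sub_le_norm_of_mem_dilationDomain {lo hi r : ℝ} {ζ : ℂ} (hζ : ζ ∈ dilationDomain lo hi r) : lo - r ≤ ‖ζ‖ := by
  simp only [dilationDomain, Set.mem_iUnion, mem_closedBall, exists_prop] at hζ
  obtain ⟨x, hx, hζx⟩ := hζ
  rw [dist_eq_norm] at hζx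
  have h1 : ‖(x : ℂ)‖ - ‖(x : ℂ) - ζ‖ ≤ ‖ζ‖ := by
    have := norm_sub_norm_le (x : ℂ) ((x : ℂ) - ζ)
    rwa [sub_sub_cancel] at this
  have h2 : ‖(x : ℂ) - ζ‖ ≤ r := by rwa [norm_sub_rev]
  have h3 : x ≤ ‖(x : ℂ)‖ := by rw [Complex.norm_real, Real.norm_eq_abs]; exact le_abs_self x
  linarith [hx.1]

/-- **Powers of the coupling, negative ones included, are holomorphic on the dilation domain** when `r < lo` (aperture
`c < 1`): the coupling factors `a_m(ζ) = ζ^{n}`, `n ∈ ℤ`, of the (2.12) structure. [folklore] -/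
theorem differentiableOn_zpow_dilationDomain {lo hi r : ℝ} (hr : r < lo) (n : ℤ) :
    DifferentiableOn ℂ (fun ζ : ℂ => ζ ^ n) (dilationDomain lo hi r) := by
  refine differentiableOn_id.zpow (Or.inl fun ζ hζ => ?_)
  have h := sub_le_norm_of_mem_dilationDomain hζ
  exact norm_pos_iff.1 (by linarith)

/-- **THE DILATED FIELD STAYS IN THE `(1+c)ε₁` POLYDISC.**  If the field `w` is small at the LARGER coupling,
`‖ℓ_b w‖ < ε₁/hi` on `ab`, and `‖ζ‖ ≤ hi + c·lo` (`0 < lo ≤ hi`, `0 ≤ c`), then `‖ℓ_b(ζ • w)‖ < (1 + c)ε₁` on `ab`: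
`(hi + c·lo)/hi ≤ 1 + c`.  This is the arithmetic behind «Lemma 2 with `ε₁ ↦ (1+c)ε₁`» ([S1-c]).
[cite: Balaban1988RG2Cluster, (1.34) p.9; Balaban1987RG1, (2.12) p.268] -/
theorem smul_mem_smallFieldPolydisc {ab : Finset Bd} {ℓ : Bd → W →L[ℂ] Vc} {ε₁ lo hi c : ℝ} {w : W} {ζ : ℂ}
    (hlo : 0 < lo) (hlh : lo ≤ hi) (hc : 0 ≤ c) (hw : ∀ b ∈ ab, ‖ℓ b w‖ < ε₁ / hi) (hζ : ‖ζ‖ ≤ hi + c * lo) :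
    ζ • w ∈ smallFieldPolydisc ab ℓ ((1 + c) * ε₁) := by
  intro b hb
  have hhi : 0 < hi := hlo.trans_le hlh
  have hwb := hw b hb
  have hε : 0 < ε₁ := by
    have : 0 < ε₁ / hi := (norm_nonneg _).trans_lt hwb
    exact (div_pos_iff_of_pos_right hhi).1 this
  have hfac : 0 < hi + c * lo := by positivity
  rw [map_smul, norm_smul]
  calc ‖ζ‖ * ‖ℓ b w‖ ≤ (hi + c * lo) * ‖ℓ b w‖ := mul_le_mul_of_nonneg_right hζ (norm_nonneg _)
    _ < (hi + c * lo) * (ε₁ / hi) := mul_lt_mul_of_pos_left hwb hfac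
    _ ≤ (1 + c) * ε₁ := by
        rw [mul_div_assoc', div_le_iff₀ hhi]
        nlinarith [mul_nonneg hc hε.le, hlh]

/-- The exponent tables with the (2.12) DILATION STRUCTURE of [I] p. 268 («every term is a power of `g_k` times a
function of `g_kCB`»; [II] (1.33) p. 9: the curly bracket is `𝐄_k` at the background shifted by `exp iB′`, `B′ = g_kCB`):
at complex coupling `ζ` and sample `ω`, `Σ_{m ∈ terms} a_m(ζ)·F_m(ζ • φ ω)` — `a_m` the explicit coupling factor (a
power of `ζ`), `F_m` the function of the dilated complexified field, `φ ω ∈ W` the sample's fluctuation field.  A SHAPE;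
nothing of Bałaban's construction is modelled beyond it. [cite: Balaban1987RG1, (2.12) p.268; Balaban1988RG2Cluster, (1.33) p.9] -/
def dilTables {Ω : Type*} {TM : Type*} (terms : Finset TM) (a : TM → ℂ → ℂ) (F : TM → W → ℂ) (φ : Ω → W)
    (ζ : ℂ) (ω : Ω) : ℂ :=
  ∑ m ∈ terms, a m ζ * F m (ζ • φ ω)

/-- **HOLOMORPHY OF THE DILATED TABLES (chain rule)**: if every `F_m` is holomorphic on a set `U` of fields, every
`a_m` is holomorphic on a set `D` of couplings, and `ζ • w ∈ U` for `ζ ∈ D`, then `ζ ↦ Σ_m a_m(ζ)F_m(ζ • w)` is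
holomorphic on `D`. [folklore] -/
theorem differentiableOn_dilTables {Ω : Type*} {TM : Type*} {terms : Finset TM} {a : TM → ℂ → ℂ} {F : TM → W → ℂ}
    {φ : Ω → W} {U : Set W} {D : Set ℂ} (ha : ∀ m ∈ terms, DifferentiableOn ℂ (a m) D)
    (hF : ∀ m ∈ terms, DifferentiableOn ℂ (F m) U) {ω : Ω} (hD : ∀ ζ ∈ D, ζ • φ ω ∈ U) :
    DifferentiableOn ℂ (fun ζ => dilTables terms a F φ ζ ω) D := by
  unfold dilTables
  refine DifferentiableOn.fun_sum fun m hm => (ha m hm).mul ?_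
  exact (hF m hm).comp (differentiable_id.smul_const (φ ω)).differentiableOn hD

/-- **[S1-c] — THE TABLE CHANNEL'S POINTWISE MODULUS, PROVED.**  Let the `F_m` be holomorphic on the complex small-field
polydisc of radius `(1 + c)ε₁` [printed TYPE: [II] Lemmas 1–2 «defined and analytic on the space (1.34)», read at
`ε₁ ↦ (1+c)ε₁`], the coupling factors `a_m` holomorphic on the dilation domain of `[min(s,s′), max(s,s′)]` with radius
`c·min(s,s′)` (powers of `ζ`), the sample's field SMALL AT THE LARGER COUPLING (`‖ℓ_b(φ ω)‖ < ε₁/max(s,s′)` on `ab` —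
i.e. `ω ∈ S(s) ∩ S(s′)`), and the dilated tables bounded by `E` on the dilation domain [printed TYPE: the box bounds
(1.36)/(1.43)/(2.20) at `(1+c)ε₁`].  Then `‖V_s(ω) − V_{s′}(ω)‖ ≤ 4E/(c·min(s,s′))·|s − s′|`: the dilated field stays in
the polydisc (`smul_mem_smallFieldPolydisc`), the dilated tables are holomorphic on the dilation domain
(`differentiableOn_dilTables`), and Cauchy on the `c·min`-discs about the real couplings (tree
`Dimock2015.real_param_lipschitz`) gives the modulus.
[cite: Balaban1988RG2Cluster, Lemma 1 (1.33)-(1.36) p.9 and Lemma 2 (1.42)-(1.43) p.11; Balaban1987RG1, (2.12) p.268; DimockYuan2024GNFlow, proof of Thm 4] -/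
theorem norm_dilTables_sub_le {Ω : Type*} {TM : Type*} {terms : Finset TM} {a : TM → ℂ → ℂ} {F : TM → W → ℂ}
    {φ : Ω → W} {ab : Finset Bd} {ℓ : Bd → W →L[ℂ] Vc} {ε₁ c s s' E : ℝ} {ω : Ω}
    (hc : 0 < c) (hs : 0 < s) (hs' : 0 < s')
    (hF : ∀ m ∈ terms, DifferentiableOn ℂ (F m) (smallFieldPolydisc ab ℓ ((1 + c) * ε₁)))
    (ha : ∀ m ∈ terms, DifferentiableOn ℂ (a m) (dilationDomain (min s s') (max s s') (c * min s s')))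
    (hw : ∀ b ∈ ab, ‖ℓ b (φ ω)‖ < ε₁ / max s s')
    (hE : ∀ ζ ∈ dilationDomain (min s s') (max s s') (c * min s s'), ‖dilTables terms a F φ ζ ω‖ ≤ E) :
    ‖dilTables terms a F φ s ω - dilTables terms a F φ s' ω‖ ≤ 4 * E / (c * min s s') * |s - s'| := by
  have hmin : 0 < min s s' := lt_min hs hs'
  have hϱ : 0 < c * min s s' := mul_pos hc hmin
  have hD : ∀ ζ ∈ dilationDomain (min s s') (max s s') (c * min s s'),
      ζ • φ ω ∈ smallFieldPolydisc ab ℓ ((1 + c) * ε₁) := fun ζ hζ =>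
    smul_mem_smallFieldPolydisc hmin min_le_max hc.le hw (norm_le_of_mem_dilationDomain hmin.le hζ)
  have hhol := differentiableOn_dilTables ha hF hD
  have h := real_param_lipschitz (g := fun ζ => dilTables terms a F φ ζ ω) hϱ hhol hE
    (fun x hx => closedBall_subset_dilationDomain hx) (s := s) (t := s')
    ⟨min_le_left _ _, le_max_left _ _⟩ ⟨min_le_right _ _, le_max_right _ _⟩
  exact h

end Dilation

/-! ## §2 The composed instance: (2.14)-form activities whose exponent has the (2.12) dilation structure -/

section Instance

variable {Ω : Type*} [MeasurableSpace Ω] {W : Type*} [NormedAddCommGroup W] [NormedSpace ℂ W] {Vc : Type*}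
  [NormedAddCommGroup Vc] [NormedSpace ℂ Vc] {Bd : Type*}

/-- **TWO-POINT BOUND IN THE LAST COUPLING FOR (2.14)-FORM ACTIVITIES WITH DILATION-STRUCTURED TABLES — [S1-c] inside,
every remaining input displayed with its printed TYPE.**  Activity `H_x = ∫ 1_{S(x)}·pre·exp(Σ_m a_m(x)F_m(x • φ)) dμ`
with the cut-off `S(x) = cutoffLF sb lb B ε₁ x` (small-field factors on `sb ⊇ ab`, large-field factors on `lb`), the bond
coordinates of the complexified field dominated by the cut-off's bond variables (`‖ℓ_b(φ ω)‖ ≤ |B_b(ω)|`).  Displayed: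
(i) `F_m` holomorphic on the `(1+c)ε₁` polydisc [[II] Lemma 1–2 TYPE at `ε₁ ↦ (1+c)ε₁`]; (ii) `a_m` holomorphic on the
dilation domain [powers of the coupling]; (iii) the box bound `ê` of the tables on the cut-off sets and the box bound
`ê₁` of the DILATED tables on the common region [(1.36)/(1.43)/(2.20) TYPE]; (iv) the `ê₁`-weighted cut-off majorant on
the common region `≤ T₁` [(A″₁): PROOF-INTERIOR of (B)]; (v) the shell majorant `≤ Sh` [(SHELL): kernel in Gaussian
letters up to the dictionary (2.15)–(2.22), `NE9TiltedShell` with bond set `sb ∪ lb` by `cutoffLF_symmDiff_subset`];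
measurability/integrability checklist.  Conclusion: `‖H_s − H_{s′}‖ ≤ (4|s − s′|/(c·min(s,s′)))·T₁ + Sh` — on the
window `]0, γ]` both moduli are bounded in `t = g⁻²` (`NE9FluctuationStep.inv_min_mul_abs_sub_le`,
`NE9CutoffShell.inv_sub_inv_le`).  No holomorphy is asked of any sample outside `S(s) ∩ S(s′)`.
[cite: Balaban1988RG2Cluster, (1.33)-(1.36) p.9, (1.42)-(1.43) p.11, (2.3) p.12, (2.14)-(2.15) p.15, (2.20) p.16; Balaban1987RG1, (2.12) p.268; DimockYuan2024GNFlow, proof of Thm 4] -/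
theorem norm_formAct_sub_formAct_le_dilTables {μ : Measure Ω} {sb lb ab : Finset Bd} {B : Bd → Ω → ℝ}
    {pre : Ω → ℂ} {φ : Ω → W} {ℓ : Bd → W →L[ℂ] Vc} {TM : Type*} {terms : Finset TM} {a : TM → ℂ → ℂ}
    {F : TM → W → ℂ} {e e₁ : Ω → ℝ} {ε₁ c s s' T₁ Sh : ℝ}
    (hB : ∀ b, Measurable (B b)) (hpre : AEStronglyMeasurable pre μ)
    (hVs : AEStronglyMeasurable (fun ω => dilTables terms a F φ s ω) μ)
    (hVs' : AEStronglyMeasurable (fun ω => dilTables terms a F φ s' ω) μ)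
    (hint₀ : Integrable (fun ω => ‖pre ω‖ * Real.exp (e ω)) μ)
    (hint₁ : Integrable (fun ω => ‖pre ω‖ * e₁ ω * Real.exp (e ω)) μ)
    (hc : 0 < c) (hs : 0 < s) (hs' : 0 < s')
    -- the link between the cut-off's bond variables and the polydisc's bond coordinates
    (hab : ab ⊆ sb) (hlink : ∀ ω, ∀ b ∈ ab, ‖ℓ b (φ ω)‖ ≤ |B b ω|)
    -- (i)/(ii): analyticity — [II] Lemma 1–2 TYPE at (1+c)ε₁; coupling factors
    (hF : ∀ m ∈ terms, DifferentiableOn ℂ (F m) (smallFieldPolydisc ab ℓ ((1 + c) * ε₁)))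
    (ha : ∀ m ∈ terms, DifferentiableOn ℂ (a m) (dilationDomain (min s s') (max s s') (c * min s s')))
    -- (iii): box bounds — (1.36)/(1.43)/(2.20) TYPE — on the cut-off sets, and dilated on the common region
    (hbd : ∀ ω ∈ cutoffLF sb lb B ε₁ s, ‖dilTables terms a F φ s ω‖ ≤ e ω)
    (hbd' : ∀ ω ∈ cutoffLF sb lb B ε₁ s', ‖dilTables terms a F φ s' ω‖ ≤ e ω)
    (hdil : ∀ ω ∈ cutoffLF sb lb B ε₁ s ∩ cutoffLF sb lb B ε₁ s',
      ∀ ζ ∈ dilationDomain (min s s') (max s s') (c * min s s'), ‖dilTables terms a F φ ζ ω‖ ≤ e₁ ω)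
    -- (iv) (A″₁) on the common region; (v) (SHELL)
    (hT₁ : ∫ ω, (cutoffLF sb lb B ε₁ s ∩ cutoffLF sb lb B ε₁ s').indicator
      (fun ω => ‖pre ω‖ * e₁ ω * Real.exp (e ω)) ω ∂μ ≤ T₁)
    (hSh : ∫ ω, (cutoffLF sb lb B ε₁ s ∆ cutoffLF sb lb B ε₁ s').indicator
      (fun ω => ‖pre ω‖ * Real.exp (e ω)) ω ∂μ ≤ Sh) :
    ‖formAct μ (cutoffLF sb lb B ε₁) pre (fun x ω => dilTables terms a F φ x ω) s -
        formAct μ (cutoffLF sb lb B ε₁) pre (fun x ω => dilTables terms a F φ x ω) s'‖ ≤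
      4 * |s - s'| / (c * min s s') * T₁ + Sh := by
  have hmin : 0 < min s s' := lt_min hs hs'
  have hL : 0 ≤ 4 * |s - s'| / (c * min s s') := by positivity
  refine norm_formAct_sub_formAct_le_local (fun x => measurableSet_cutoffLF sb lb hB ε₁ x) hpre hVs hVs' hint₀ hint₁
    hL hbd hbd' (fun ω hω => ?_) hT₁ hSh
  have hw : ∀ b ∈ ab, ‖ℓ b (φ ω)‖ < ε₁ / max s s' := fun b hb =>
    (hlink ω b hb).trans_lt (abs_lt_of_mem_inter hω (hab hb))
  have h := norm_dilTables_sub_le hc hs hs' hF ha hw (hdil ω hω)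
  calc ‖dilTables terms a F φ s ω - dilTables terms a F φ s' ω‖ ≤ 4 * e₁ ω / (c * min s s') * |s - s'| := h
    _ = 4 * |s - s'| / (c * min s s') * e₁ ω := by ring

end Instance

end Summit.QuantumFields.BalabanUV.T4Continuum.NE9DilatedTables

end
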